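import Mathlib
import Literature.Analysis.FluidPDE.StretchedLayerNS
import Summits.AnomalousDissipation.AnomalousDissipation.Theses.MarginalStabilityChain
import Summits.AnomalousDissipation.AnomalousDissipation.Theorems.MarginalStabilityChainStretchedVortexRowsStubNewmanDifferentiable
import Summits.AnomalousDissipation.AnomalousDissipation.Theorems.MarginalStabilityChainStretchedVortexRowsStubNewmanRotate
import Summits.AnomalousDissipation.AnomalousDissipation.Theorems.MarginalStabilityChainStretchedVortexRowsStubNewmanRayBound
import Summits.AnomalousDissipation.AnomalousDissipation.Theorems.MarginalStabilityChainStretchedVortexRowsStubNewmanGrowthPoints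
import Summits.AnomalousDissipation.AnomalousDissipation.Theorems.MarginalStabilityChainStretchedVortexRowsStubPotentialFlow
import Summits.AnomalousDissipation.AnomalousDissipation.Theorems.MarginalStabilityChainStretchedVortexRowsStubFarField
import Summits.AnomalousDissipation.AnomalousDissipation.Theorems.MarginalStabilityChainStretchedVortexRowsStubDissipationTop
import HarnessLib

/-!
# `StretchedVortexRows` as filed holds — through the `ℝ≥0∞` loophole (potential-flow witness)

Crux `stmt-AnomalousDissipation-3009` (`MarginalStabilityChain.StretchedVortexRows`), line
`potential-flow-essential-singularity` (lead seat c1). This file composes the seven landed stubs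
(`…StubNewmanDifferentiable`, `…StubNewmanRotate`, `…StubNewmanRayBound`, `…StubNewmanGrowthPoints`,
`…StubPotentialFlow`, `…StubFarField`, `…StubDissipationTop`) into `StretchedVortexRows_of`.

## What is proved, and why it is the WRONG physical reason

The crux AS FILED asks, for every period `L > 0` and every small `ν > 0`, for a steady classical
`L`-periodic member `(u, v, p)` of the stretched two-dimensional Navier–Stokes class with the
shear far field `u → ±1/2`, `v → 0` as `y → ±∞` **pointwise in `x`**, whose dissipation per unit
area — an EXTENDED real `(ν/L)∫⁻∫⁻ |∇(u,v)|² ∈ [0, ∞]` — is `≥ c·min(L,1)`. As the standing disprover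
recorded (`Cruxes/StretchedVortexRows/Disproof.lean` §1), a class member with INFINITE Dirichlet
integral witnesses that inequality for every `c`; we construct one, for every `L > 0` and every `ν`:

* IRROTATIONAL members (`stub_potentialFlow`): for an ENTIRE `L`-periodic `Φ`, `u - iv = Φ(x+iy)`
  gives harmonic conjugates (`Δu = Δv = 0`, `∂ₓu + ∂_yv = 0`, `∂_yu = ∂ₓv`), and
  `p = -(u² + v²)/2 + y v` balances both momentum equations identically (Bernoulli for the
  potential flow `(u, v - y, z)` of 3-D Navier–Stokes), whatever the viscosity.
* The pointwise far field `Φ(x+iy) → ±1/2` along every vertical line is impossible for a bounded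
  `Φ` (Liouville on the cylinder) and is realised through an ESSENTIAL singularity at `y = ±∞`:
  `Φ(z) = 1/2 - (N(c + w) - N(c))/(w N'(c))`, `w = e^{-2πiz/L}`, where
  `N(z) = ∫_ℝ exp(z eᵗ - t eᵗ + t) dt = ∫₀^∞ e^{zs} s^{-s} ds` is D. J. Newman's entire function
  bounded on every ray off the positive real axis (Amer. Math. Monthly 83 (1976) 192–193):
  `N` is entire (`stub_newmanDifferentiable`); its line of integration shifts to `Im t = φ`,
  `|φ| < π/2` (`stub_newmanRotate`, Cauchy–Goursat); hence from a base point `c`, `Im c = 4`,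
  `N` is eventually `≤ e^{1/e}` along every ray (`stub_newmanRayBound`); so `Φ → 1/2` as `y → +∞`
  (`w → ∞` along a ray) and `Φ → 1/2 - 1` as `y → -∞` (`w → 0`, difference quotient `→ N'(c)`),
  for each fixed `x` (`stub_farField`). The base point with `N'(c) ≠ 0` exists by the identity
  theorem since `N 0 ≠ N 1` (`exists_deriv_ne_zero_of_ne`, `stub_newmanGrowthPoints`).
* On the real axis `N(T) ≳ e^T`, so on every far horizontal line `|Φ|` is huge where `c + w` is
  real positive while `Φ(L/2 + iy)` stays bounded (`stub_newmanGrowthPoints`); by the mean-square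
  inequality and Tonelli `∫⁻_{(0,L]}∫⁻_ℝ |Φ'|² = ⊤` (`stub_dissipationTop`), and
  `|∇u|² + |∇v|² ≥ (∂ₓu)² + (∂ₓv)² = |Φ'|²`, so `layerDissipation = ⊤ ≥ ofReal(c·min(L,1))`.

So the statement closes because the far field is only pointwise in `x` and the dissipation is not
required to be finite — not because stretched vortex rows exist. The witness is a potential flow of
infinite energy, physically void. The planner's repair is Disproof §6: add `layerDissipation < ⊤`
and a Gaussian vorticity bound (or a far field uniform in `x`); under either clause this witness
disappears and the co-rotating Burgers row (line `braid-closed-large-circulation-gluing`) is again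
the content of the crux.
-/

-- summit and problem are both named `AnomalousDissipation`, so every name repeats the component
set_option linter.dupNamespace false

noncomputable section

open scoped Topology ENNReal Real
open Filter Set Function MeasureTheory Complex

namespace Summit.AnomalousDissipation.AnomalousDissipation.Theorems
namespace MarginalStabilityChainStretchedVortexRows
namespace PotentialFlow

open Literature.Analysis.FluidPDE Literature.Analysis.FluidPDE.StretchedLayer
open Summit.AnomalousDissipation.AnomalousDissipation.Theses.MarginalStabilityChain

/-! ## The typed bridge (Disproof §0–§1, re-proved so that this file is self-contained) -/

/-- One witness clause of the inlined crux ⇔ the typed structure plus the dissipation bound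
(adapted from `Cruxes/StretchedVortexRows/Disproof.lean`, cdisprove seat). [folklore] -/
theorem witness_iff (c L ν : ℝ) (u v p : ℝ → ℝ → ℝ) :
    (ContDiff ℝ 2 (fun q : ℝ × ℝ => u q.1 q.2) ∧ ContDiff ℝ 2 (fun q : ℝ × ℝ => v q.1 q.2) ∧
      ContDiff ℝ 1 (fun q : ℝ × ℝ => p q.1 q.2) ∧
      (∀ x y, u x y * dX u x y + (v x y - y) * dY u x y = -dX p x y + ν * (dX (dX u) x y + dY (dY u) x y) ∧
        u x y * dX v x y + (v x y - y) * dY v x y - v x y = -dY p x y + ν * (dX (dX v) x y + dY (dY v) x y) ∧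
        dX u x y + dY v x y = 0) ∧
      (∀ x y, u (x + L) y = u x y ∧ v (x + L) y = v x y ∧ p (x + L) y = p x y) ∧
      (∀ x, Tendsto (fun y => u x y) atTop (𝓝 (1 / 2)) ∧ Tendsto (fun y => u x y) atBot (𝓝 (-(1 / 2))) ∧
        Tendsto (fun y => v x y) atTop (𝓝 0) ∧ Tendsto (fun y => v x y) atBot (𝓝 0)) ∧
      ENNReal.ofReal (c * min L 1) ≤ ENNReal.ofReal (ν / L) *
        ∫⁻ x in Ioc 0 L, ∫⁻ y, ENNReal.ofReal (dX u x y ^ 2 + dY u x y ^ 2 + dX v x y ^ 2 + dY v x y ^ 2)) ↔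
    (IsSteadyStretchedLayerNSSolution ν 1 1 L u v p ∧ ENNReal.ofReal (c * min L 1) ≤ layerDissipation ν L u v) := by
  constructor
  · rintro ⟨hu, hv, hp, hpde, hper, hfar, hD⟩
    refine ⟨⟨hu, hv, hp, ?_, ?_, fun x y => (hpde x y).2.2, fun x y => (hper x y).1,
      fun x y => (hper x y).2.1, fun x y => (hper x y).2.2, ?_, ?_, fun x => (hfar x).2.2.1,
      fun x => (hfar x).2.2.2⟩, hD⟩
    · intro x y; simpa only [one_mul, lap_apply] using (hpde x y).1
    · intro x y; simpa only [one_mul, lap_apply] using (hpde x y).2.1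
    · intro x; simpa using (hfar x).1
    · intro x; simpa using (hfar x).2.1
  · rintro ⟨h, hD⟩
    refine ⟨h.contDiff_u, h.contDiff_v, h.contDiff_p, fun x y => ⟨?_, ?_, h.divFree x y⟩,
      fun x y => ⟨h.periodic_u x y, h.periodic_v x y, h.periodic_p x y⟩,
      fun x => ⟨?_, ?_, h.tendsto_v_atTop x, h.tendsto_v_atBot x⟩, hD⟩
    · simpa only [one_mul, lap_apply] using h.momentum_x x y
    · simpa only [one_mul, lap_apply] using h.momentum_y x y
    · simpa using h.tendsto_u_atTop x
    · simpa using h.tendsto_u_atBot x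

/-- **Loophole, typed form** (Disproof §1, re-proved): steady members of infinite `layerDissipation`
for every `L > 0`, `ν > 0` give `StretchedVortexRows` with `c = ν₀ = 1`. [folklore] -/
theorem stretchedVortexRows_of_infinite_witnesses
    (h : ∀ L : ℝ, 0 < L → ∀ ν : ℝ, 0 < ν →
      ∃ u v p : ℝ → ℝ → ℝ, IsSteadyStretchedLayerNSSolution ν 1 1 L u v p ∧ layerDissipation ν L u v = ⊤) :
    StretchedVortexRows := by
  refine ⟨1, one_pos, fun L hL => ⟨1, one_pos, fun ν hν _ => ?_⟩⟩
  obtain ⟨u, v, p, hsol, htop⟩ := h L hL ν hν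
  refine ⟨u, v, p, ?_⟩
  have key : IsSteadyStretchedLayerNSSolution ν 1 1 L u v p ∧
      ENNReal.ofReal (1 * min L 1) ≤ layerDissipation ν L u v := ⟨hsol, by rw [htop]; exact le_top⟩
  exact (witness_iff 1 L ν u v p).2 key

/-! ## Glue: nondegenerate base point, and the complex velocity `Φ` -/

/-- **Nondegeneracy** (identity theorem): an entire function with `F 0 ≠ F 1` has a point on the
line `Im = 4` where `F' ≠ 0` — otherwise `F'`, analytic and vanishing on a set accumulating at `4i`,
vanishes identically and `F` is constant. [folklore] -/
theorem exists_deriv_ne_zero_of_ne (F : ℂ → ℂ) (hF : Differentiable ℂ F) (h01 : F 0 ≠ F 1) :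
    ∃ c : ℂ, c.im = 4 ∧ deriv F c ≠ 0 := by
  by_contra hcon
  push Not at hcon
  have hA0 : AnalyticOnNhd ℂ F univ := fun z _ => hF.analyticAt z
  have hA : AnalyticOnNhd ℂ (deriv F) univ := hA0.deriv
  -- `deriv F` vanishes frequently near `4 I` (along the horizontal line through it)
  have hfreq : ∃ᶠ z in 𝓝[≠] ((4 : ℂ) * I), deriv F z = 0 := by
    have ht : Tendsto (fun t : ℝ => (t : ℂ) + 4 * I) (𝓝[≠] 0) (𝓝[≠] ((4 : ℂ) * I)) := by
      refine tendsto_nhdsWithin_of_tendsto_nhds_of_eventually_within _ ?_ ?_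
      · have : Continuous fun t : ℝ => (t : ℂ) + 4 * I := by fun_prop
        simpa using (this.tendsto 0).mono_left nhdsWithin_le_nhds
      · filter_upwards [self_mem_nhdsWithin] with t ht
        simp only [mem_compl_iff, mem_singleton_iff, add_eq_right, ofReal_eq_zero]
        exact ht
    refine ht.frequently (Eventually.frequently (Eventually.of_forall fun t => ?_))
    exact hcon _ (by simp)
  have hzero : EqOn (deriv F) 0 univ :=
    hA.eqOn_zero_of_preconnected_of_frequently_eq_zero isPreconnected_univ (mem_univ _) hfreq
  exact h01 (is_const_of_deriv_eq_zero hF (fun x => hzero (mem_univ x)) 0 1)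

/-- The complex velocity `Φ(z) = 1/2 - (N(c + w) - N(c)) w⁻¹ / N'(c)`, `w = e^{-2πiz/L}` (spelled
with `w⁻¹ = e^{+2πiz/L}`), is entire when `N` is. [folklore] -/
theorem differentiable_phi (N : ℂ → ℂ) (hN : Differentiable ℂ N) (c : ℂ) (L : ℝ) :
    Differentiable ℂ (fun z : ℂ => (1 / 2 : ℂ) -
      (N (c + Complex.exp (-(((2 * π / L : ℝ) : ℂ) * z * I))) - N c) *
        Complex.exp (((2 * π / L : ℝ) : ℂ) * z * I) / deriv N c) := by
  have h1 : Differentiable ℂ fun z : ℂ => Complex.exp (-(((2 * π / L : ℝ) : ℂ) * z * I)) := by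
    fun_prop
  have h2 : Differentiable ℂ fun z : ℂ => Complex.exp (((2 * π / L : ℝ) : ℂ) * z * I) := by
    fun_prop
  have h3 : Differentiable ℂ fun z : ℂ =>
      N (c + Complex.exp (-(((2 * π / L : ℝ) : ℂ) * z * I))) :=
    hN.comp (h1.const_add c)
  exact ((h3.sub_const _).mul h2).div_const _ |>.const_sub _

/-- `Φ` is `L`-periodic (`e^{∓2πi(z+L)/L} = e^{∓2πiz/L}`). [folklore] -/
theorem phi_periodic (N : ℂ → ℂ) (c : ℂ) {L : ℝ} (hL : L ≠ 0) (z : ℂ) :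
    (1 / 2 : ℂ) - (N (c + Complex.exp (-(((2 * π / L : ℝ) : ℂ) * (z + L) * I))) - N c) *
        Complex.exp (((2 * π / L : ℝ) : ℂ) * (z + L) * I) / deriv N c =
      (1 / 2 : ℂ) - (N (c + Complex.exp (-(((2 * π / L : ℝ) : ℂ) * z * I))) - N c) *
        Complex.exp (((2 * π / L : ℝ) : ℂ) * z * I) / deriv N c := by
  have hL' : (L : ℂ) ≠ 0 := ofReal_ne_zero.2 hL
  have hk : ((2 * π / L : ℝ) : ℂ) * (L : ℂ) = 2 * π := by
    push_cast; field_simp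
  have e1 : Complex.exp (-(((2 * π / L : ℝ) : ℂ) * (z + L) * I)) =
      Complex.exp (-(((2 * π / L : ℝ) : ℂ) * z * I)) := by
    rw [show -(((2 * π / L : ℝ) : ℂ) * (z + L) * I) =
        -(((2 * π / L : ℝ) : ℂ) * z * I) + (-1 : ℤ) * (2 * π * I) by rw [mul_add, hk.symm]; push_cast; ring,
      Complex.exp_add, Complex.exp_int_mul_two_pi_mul_I, mul_one]
  have e2 : Complex.exp (((2 * π / L : ℝ) : ℂ) * (z + L) * I) =
      Complex.exp (((2 * π / L : ℝ) : ℂ) * z * I) := by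
    rw [show ((2 * π / L : ℝ) : ℂ) * (z + L) * I =
        ((2 * π / L : ℝ) : ℂ) * z * I + (1 : ℤ) * (2 * π * I) by rw [mul_add, hk.symm]; push_cast; ring,
      Complex.exp_add, Complex.exp_int_mul_two_pi_mul_I, mul_one]
  rw [e1, e2]

/-! ## The witness and the composition -/

/-- For every `L > 0` and every `ν > 0` the stretched class has a steady member (a potential flow with
an essential singularity at `y = ±∞`) with `u → ±1/2`, `v → 0` pointwise in `x` and
`layerDissipation = ⊤`. [folklore] -/
theorem exists_infinite_witness (L : ℝ) (hL : 0 < L) (ν : ℝ) (hν : 0 < ν) :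
    ∃ u v p : ℝ → ℝ → ℝ, IsSteadyStretchedLayerNSSolution ν 1 1 L u v p ∧ layerDissipation ν L u v = ⊤ := by
  -- Newman's entire function
  set N : ℂ → ℂ := fun z : ℂ => ∫ τ : ℝ,
    Complex.exp (z * Complex.exp (τ : ℂ) - (τ : ℂ) * Complex.exp (τ : ℂ) + (τ : ℂ))
  have hNeq : ∀ z : ℂ, N z = ∫ τ : ℝ,
      Complex.exp (z * Complex.exp (τ : ℂ) - (τ : ℂ) * Complex.exp (τ : ℂ) + (τ : ℂ)) := fun z => rfl
  have hNdiff : Differentiable ℂ N := stub_newmanDifferentiable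
  -- the base point `c`, `Im c = 4`, `N'(c) ≠ 0`
  obtain ⟨h01, hbounded, hgrowth⟩ := stub_newmanGrowthPoints N hNeq
  obtain ⟨c, hc, hκ⟩ := exists_deriv_ne_zero_of_ne N hNdiff h01
  -- ray bound from the shifted representations
  have hray : ∀ θ : ℝ, ∃ R₀ : ℝ, ∀ R : ℝ, R₀ ≤ R →
      ‖N (c + R * Complex.exp (θ * I))‖ ≤ Real.exp (Real.exp (-1)) :=
    stub_newmanRayBound N (fun φ hφ z => by rw [hNeq]; exact stub_newmanRotate φ hφ z) c hc
  -- the complex velocity `Φ`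
  set Φ : ℂ → ℂ := fun z : ℂ => (1 / 2 : ℂ) -
    (N (c + Complex.exp (-(((2 * π / L : ℝ) : ℂ) * z * I))) - N c) *
      Complex.exp (((2 * π / L : ℝ) : ℂ) * z * I) / deriv N c with hΦdef
  have hΦdiff : Differentiable ℂ Φ := differentiable_phi N hNdiff c L
  have hΦper : ∀ z : ℂ, Φ (z + L) = Φ z := fun z => phi_periodic N c hL.ne' z
  -- far field of `Φ`
  obtain ⟨htop, hbot⟩ := stub_farField N hNdiff c hκ _ hray L hL
  have htop' : ∀ x : ℝ, Tendsto (fun y : ℝ => Φ ((x : ℂ) + (y : ℂ) * I)) atTop (𝓝 (1 / 2)) :=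
    fun x => htop x
  have hbot' : ∀ x : ℝ, Tendsto (fun y : ℝ => Φ ((x : ℂ) + (y : ℂ) * I)) atBot (𝓝 (-(1 / 2))) :=
    fun x => hbot x
  -- the steady structure
  obtain ⟨hsol, hdXu, hdXv⟩ := stub_potentialFlow Φ hΦdiff ν L hΦper htop' hbot'
  refine ⟨fun x y => (Φ ((x : ℂ) + (y : ℂ) * I)).re, fun x y => -(Φ ((x : ℂ) + (y : ℂ) * I)).im,
    fun x y => -((Φ ((x : ℂ) + (y : ℂ) * I)).re ^ 2 + (Φ ((x : ℂ) + (y : ℂ) * I)).im ^ 2) / 2 +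
      y * (-(Φ ((x : ℂ) + (y : ℂ) * I)).im), hsol, ?_⟩
  -- two-point data for `Φ` on far horizontal lines
  obtain ⟨B, hB⟩ := hbounded c L hL
  have hκpos : 0 < ‖deriv N c‖ := norm_pos_iff.2 hκ
  have hB' : ∀ y : ℝ, 0 ≤ y → ‖Φ (((L / 2 : ℝ) : ℂ) + (y : ℂ) * I)‖ ≤ 1 / 2 + B / ‖deriv N c‖ := by
    intro y hy
    have h := hB y hy
    simp only [hΦdef]
    refine (norm_sub_le _ _).trans ?_
    have h12 : ‖(1 / 2 : ℂ)‖ = 1 / 2 := by norm_num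
    rw [h12, norm_div]
    gcongr
  have hM' : ∀ M : ℝ, ∃ Y : ℝ, ∀ y : ℝ, Y ≤ y →
      ∃ x : ℝ, x ∈ Set.Ioo 0 (L / 2) ∧ M ≤ ‖Φ ((x : ℂ) + (y : ℂ) * I)‖ := by
    intro M
    obtain ⟨Y, hY⟩ := hgrowth c hc L hL ((M + 1 / 2) * ‖deriv N c‖)
    refine ⟨Y, fun y hy => ?_⟩
    obtain ⟨x, hx, hMx⟩ := hY y hy
    refine ⟨x, hx, ?_⟩
    have hq : M + 1 / 2 ≤ ‖(N (c + Complex.exp (-(((2 * π / L : ℝ) : ℂ) * ((x : ℂ) + (y : ℂ) * I) * I))) -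
        N c) * Complex.exp (((2 * π / L : ℝ) : ℂ) * ((x : ℂ) + (y : ℂ) * I) * I) / deriv N c‖ := by
      rw [norm_div, le_div_iff₀ hκpos]; exact hMx
    have : ‖(N (c + Complex.exp (-(((2 * π / L : ℝ) : ℂ) * ((x : ℂ) + (y : ℂ) * I) * I))) -
        N c) * Complex.exp (((2 * π / L : ℝ) : ℂ) * ((x : ℂ) + (y : ℂ) * I) * I) / deriv N c‖ -
        ‖(1 / 2 : ℂ)‖ ≤ ‖Φ ((x : ℂ) + (y : ℂ) * I)‖ := by
      simp only [hΦdef]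
      rw [norm_sub_rev (1 / 2 : ℂ)]
      exact norm_sub_norm_le _ _
    have h12 : ‖(1 / 2 : ℂ)‖ = 1 / 2 := by norm_num
    linarith
  have htopI := stub_dissipationTop Φ hΦdiff L hL _ hB' hM'
  -- compare the Dirichlet integrand with `|Φ'|² = (∂ₓu)² + (∂ₓv)²`
  rw [layerDissipation_def]
  have hle : (∫⁻ x in Ioc 0 L, ∫⁻ y : ℝ, ENNReal.ofReal (‖deriv Φ ((x : ℂ) + (y : ℂ) * I)‖ ^ 2)) ≤
      ∫⁻ x in Ioc 0 L, ∫⁻ y, ENNReal.ofReal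
        (dX (fun x y => (Φ ((x : ℂ) + (y : ℂ) * I)).re) x y ^ 2 +
          dY (fun x y => (Φ ((x : ℂ) + (y : ℂ) * I)).re) x y ^ 2 +
          dX (fun x y => -(Φ ((x : ℂ) + (y : ℂ) * I)).im) x y ^ 2 +
          dY (fun x y => -(Φ ((x : ℂ) + (y : ℂ) * I)).im) x y ^ 2) := by
    refine lintegral_mono fun x => lintegral_mono fun y => ENNReal.ofReal_le_ofReal ?_
    rw [hdXu x y, hdXv x y, ← Complex.normSq_eq_norm_sq, Complex.normSq_apply]
    nlinarith [sq_nonneg (dY (fun x y => (Φ ((x : ℂ) + (y : ℂ) * I)).re) x y),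
      sq_nonneg (dY (fun x y => -(Φ ((x : ℂ) + (y : ℂ) * I)).im) x y)]
  have htop2 : (∫⁻ x in Ioc 0 L, ∫⁻ y, ENNReal.ofReal
        (dX (fun x y => (Φ ((x : ℂ) + (y : ℂ) * I)).re) x y ^ 2 +
          dY (fun x y => (Φ ((x : ℂ) + (y : ℂ) * I)).re) x y ^ 2 +
          dX (fun x y => -(Φ ((x : ℂ) + (y : ℂ) * I)).im) x y ^ 2 +
          dY (fun x y => -(Φ ((x : ℂ) + (y : ℂ) * I)).im) x y ^ 2)) = ⊤ :=
    eq_top_iff.2 (htopI ▸ hle)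
  rw [htop2, ENNReal.mul_top (by simpa using div_pos hν hL)]

/-- **The crux as filed.** `MarginalStabilityChain.StretchedVortexRows` holds (with `c = ν₀ = 1`),
witnessed for every `L > 0` and every `ν > 0` by an irrotational steady member of infinite
dissipation — see the module docstring for why this is the `ℝ≥0∞`/pointwise-far-field loophole
and not the intended stretched vortex row. [folklore] -/
theorem StretchedVortexRows_of : StretchedVortexRows :=
  stretchedVortexRows_of_infinite_witnesses fun L hL ν hν => exists_infinite_witness L hL ν hν

end PotentialFlow
end MarginalStabilityChainStretchedVortexRows
end Summit.AnomalousDissipation.AnomalousDissipation.Theorems
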